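import Literature.NumberTheory.Automorphic.LocalConstantsUniqueness
import HarnessLib

/-!
# Stub `stub_prod_tprod_isEquivalent` for line `Sketch_18745_r1_k1` (crux stmt-Langlands-18745)

**Tensoring distributes over direct sums of Weil–Deligne representations, up to isomorphism.**
For Weil–Deligne representations `r = (V, ρ, N)`, `r' = (V', ρ', N')`, `t = (U, τ, M)` of the Weil
group of a non-archimedean local field, Mathlib's linear isomorphism
`TensorProduct.prodLeft : (V × V') ⊗ U ≃ₗ (V ⊗ U) × (V' ⊗ U)`, `(x, y) ⊗ u ↦ (x ⊗ u, y ⊗ u)`,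
intertwines the Weil group actions `(ρ ⊕ ρ') ⊗ τ` and `(ρ ⊗ τ) ⊕ (ρ' ⊗ τ)` and the monodromy
operators `(N ⊕ N') ⊗ 1 + 1 ⊗ M` and `(N ⊗ 1 + 1 ⊗ M) ⊕ (N' ⊗ 1 + 1 ⊗ M)` (both checked on pure
tensors `(x, y) ⊗ u`), hence is an isomorphism `(r ⊕ r') ⊗ t ≅ (r ⊗ t) ⊕ (r' ⊗ t)` of
Weil–Deligne representations.

Ref: P. Deligne, *Les constantes des équations fonctionnelles des fonctions L* (Antwerp II,
LNM 349, 1973), §8.4.1 (the operations `⊕`, `⊗` on Weil–Deligne representations), §8.12.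
-/

set_option linter.dupNamespace false -- `Summit.Langlands.Langlands` is the mandated namespace

noncomputable section

open scoped TensorProduct
open Module Literature.NumberTheory.Automorphic Literature.NumberTheory.GaloisRepresentations

namespace Summit.Langlands.Langlands.Theorems.ReciprocityRigidity

variable {F : Type} [Field F] [ValuativeRel F] [TopologicalSpace F] [IsNonarchimedeanLocalField F]

/-- **Distributivity of `⊗` over `⊕` for Weil–Deligne representations**:
`(r ⊕ r') ⊗ t ≅ (r ⊗ t) ⊕ (r' ⊗ t)`, the isomorphism being Mathlib's `TensorProduct.prodLeft`
(`(x, y) ⊗ u ↦ (x ⊗ u, y ⊗ u)`), which intertwines both the Weil group actions and the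
monodromy operators. [cite: DeligneAntwerpII1973, §8.4.1] -/
theorem stub_prod_tprod_isEquivalent
    {V : Type*} [AddCommGroup V] [Module ℂ V] {V' : Type*} [AddCommGroup V'] [Module ℂ V']
    {U : Type*} [AddCommGroup U] [Module ℂ U]
    (r : WeilDeligneRep F ℂ V) (r' : WeilDeligneRep F ℂ V') (t : WeilDeligneRep F ℂ U) :
    ((r.prod r').tprod t).IsEquivalent ((r.tprod t).prod (r'.tprod t)) := by
  refine ⟨{ toRepEquiv := Representation.Equiv.mk (TensorProduct.prodLeft ℂ ℂ V V' U) fun w => ?_,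
            comm_N := ?_ }⟩
  · -- compatibility with the Weil group actions, on pure tensors `(x, y) ⊗ u`
    refine TensorProduct.ext' fun xy u => ?_
    obtain ⟨x, y⟩ := xy
    simp only [LinearMap.coe_comp, Function.comp_apply, LinearEquiv.coe_coe,
      WeilDeligneRep.tprod_ρ_apply, WeilDeligneRep.prod_ρ_apply, TensorProduct.map_tmul,
      LinearMap.prodMap_apply, TensorProduct.prodLeft_tmul]
  · -- compatibility with the monodromy operators, on pure tensors `(x, y) ⊗ u`
    refine TensorProduct.ext' fun xy u => ?_
    obtain ⟨x, y⟩ := xy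
    simp only [Representation.Equiv.toLinearMap_mk', LinearMap.coe_comp, Function.comp_apply,
      LinearEquiv.coe_coe, WeilDeligneRep.tprod_N, WeilDeligneRep.prod_N, LinearMap.add_apply,
      TensorProduct.map_tmul, LinearMap.prodMap_apply, Module.End.one_apply, map_add,
      TensorProduct.prodLeft_tmul, Prod.mk_add_mk]

end Summit.Langlands.Langlands.Theorems.ReciprocityRigidity

end
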